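import Summits.BirchSwinnertonDyer.Rank1Residual.X2.RouteGSplitDisplay52779b1
import Summits.BirchSwinnertonDyer.Rank1Residual.Partition.EisensteinKernelCertificate
import Literature.NumberTheory.EllipticCurves.Fisher2012.HesseFamilyThreeCongruenceProofs
import Literature.NumberTheory.EllipticCurves.Fisher2012.HesseFamilyThreeReverse
import Literature.NumberTheory.EllipticCurves.Rank1Residual.GVParityTwistProofs
import HarnessLib

/-!
# Route G at a split Eisenstein `3`, pair `52779b1 ← 219b1`: the GALOIS SIDE in the kernel and the landed
# display WITH `hiso` / `hred` DISCHARGED — cell `bsd-eis`, seat `bsd-eis-ky` gen 4, landing the planner's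
# farm-checked sketch `HOME/plan-g8/TorsionIso52779b1{,Certs}.lean` (FINDING F5′); THEOREMS ONLY, nothing booked

HONEST FRAMING (FULL-BSD rank-≤1 programme D-0033, cell `bsd-eis`, row A10-split: 83 cells `(E₀, 3)`,
`r = 0`, split multiplicative Eisenstein `3`, `¬GVPar`). The landed display `X2/RouteGSplitDisplay52779b1.lean`
(p399495; referee PASS, `HOME/REF-VERDICT-ky-MEMO-4-K5.md`) proves `X2.MazurMainConjectureAt 52779b1 3` and
`BSDp 52779b1 3` from twelve REGISTERED published facts and per-pair hypotheses, two of which are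
Galois-side: `hiso : TorsionIso W W' 3` and `hred : ¬Irr(E₀[3])`. Both are THEOREMS (planner F5′):
* `torsionIso_52779b1_219b1` — the member `(l : m) = (6 : 1)` of the `n = 3` Hesse pencil of `219b1`
  (`c₄ = −128`, `c₆ = −1144`) has `𝔠₄(6,1) = 17425408 = 2⁴·c₄(52779b1)` and `𝔠₆(6,1) = 73712204288 =
  2⁶·c₆(52779b1)` (`u = 2`), and Fisher 2012 Thm. 13.2 for `n = 3` is PROVED in the tree
  (`Fisher2012.threeCongruent_of_hesseCertificate_unconditional`);
* `not_irreducible_52779b1` — `x₀ = 261` is a rational root of `Ψ₃` with `Ψ₂Sq(261) = 42341049 = 6507² ≠ 0`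
  (`KernelDisc.exists_isRationalLine_of_eval_Ψ₃_eq_zero`).
Consequence (`mazurMainConjectureAt_52779b1_at_three_of_certs`, `bsdp_52779b1_at_three_of_certs`): the
display's per-pair residue is INSTRUMENT-ONLY — `hr' : r_an(219b1) = 1`, `(μ, λ)_an(52779b1) = (0, 3)`,
`(μ, λ)_an(219b1) = (0, 2)` (+ `hr : r_an(52779b1) = 0` and Greenberg–Stevens for `BSDp`); certified by
the cc tables (planner kit j238173), PARI-ms (kit j239319: `[3, 0]` / `[2, 0]`) and the referee's norm
engine (kit j239728). NOT: no kernel road to `r_an` / `(μ, λ)_an`; nothing booked, no label moved.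
References: [Fisher2012Hessian] Thm. 13.2 (`n = 3`); [GreenbergVatsal2000] Thm. (1.4), Prop. (2.4);
[Wuthrich2014] Thm. 16; HOME/TARGET.md §1.2 ROUTING v1.8.1.
-/

set_option autoImplicit false

noncomputable section

open WeierstrassCurve Literature.NumberTheory.EllipticCurves
  Literature.NumberTheory.EllipticCurves.ModularForms
  Literature.NumberTheory.EllipticCurves.Fisher2012
  Literature.NumberTheory.EllipticCurves.Rank1Residual
  Literature.NumberTheory.EllipticCurves.Rank1Residual.Typed
  Literature.NumberTheory.EllipticCurves.Rank1Residual.X11RankOneCertificates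
  Literature.NumberTheory.EllipticCurves.Wuthrich2014
  Literature.NumberTheory.EllipticCurves.SteinWuthrich2013
  Literature.NumberTheory.EllipticCurves.Greenberg1999
  Literature.NumberTheory.EllipticCurves.GreenbergVatsal2000
  Summit.BirchSwinnertonDyer.BirchSwinnertonDyer.Rank1Residual.X11RankOne
  Summit.BirchSwinnertonDyer.Rank1Residual
  Summit.BirchSwinnertonDyer.Rank1Residual.X11b
  Summit.BirchSwinnertonDyer.Rank1Residual.X1.CongruenceTransfer
  Summit.BirchSwinnertonDyer.Rank1Residual.X2.RouteGSplitDisplay52779b1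

namespace Summit.BirchSwinnertonDyer.Rank1Residual.X2.RouteGSplitDisplay52779b1Certs

/-- `c₄(219b1) = −128`. [folklore] -/
theorem c₄_219b1 : (⟨0, 1, 1, 3, 2⟩ : WeierstrassCurve ℚ).c₄ = -128 := by
  norm_num [WeierstrassCurve.c₄, WeierstrassCurve.b₂, WeierstrassCurve.b₄]

/-- `c₆(219b1) = −1144`. [folklore] -/
theorem c₆_219b1 : (⟨0, 1, 1, 3, 2⟩ : WeierstrassCurve ℚ).c₆ = -1144 := by
  norm_num [WeierstrassCurve.c₆, WeierstrassCurve.b₂, WeierstrassCurve.b₄, WeierstrassCurve.b₆]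

/-- `c₄(52779b1) = 1089088`. [folklore] -/
theorem c₄_52779b1 : (⟨0, 1, 1, -22689, -1340611⟩ : WeierstrassCurve ℚ).c₄ = 1089088 := by
  norm_num [WeierstrassCurve.c₄, WeierstrassCurve.b₂, WeierstrassCurve.b₄]

/-- `c₆(52779b1) = 1151753192`. [folklore] -/
theorem c₆_52779b1 : (⟨0, 1, 1, -22689, -1340611⟩ : WeierstrassCurve ℚ).c₆ = 1151753192 := by
  norm_num [WeierstrassCurve.c₆, WeierstrassCurve.b₂, WeierstrassCurve.b₄, WeierstrassCurve.b₆]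

/-- **`52779b1[3] ≅ 219b1[3]` as `Γ_ℚ`-modules — IN THE KERNEL.** The member `(λ : μ) = (6 : 1)` of the
`n = 3` Hesse pencil of `219b1` (`c₄ = −128`, `c₆ = −1144`) has `𝔠₄(6,1) = 17425408 = 2⁴·c₄(52779b1)` and
`𝔠₆(6,1) = 73712204288 = 2⁶·c₆(52779b1)`, so it is `ℚ`-isomorphic to `52779b1` (`u = 2`); Fisher 2012
Thm 13.2 (`n = 3`, PROVED in the tree: `thm132_threeCongruent_hessePencil_holds`) gives the equivariant
isomorphism. Discharges the display's binder `hiso`. [cite: Fisher2012Hessian, Thm. 13.2 (n = 3)] -/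
theorem torsionIso_52779b1_219b1 :
    TorsionIso (⟨0, 1, 1, -22689, -1340611⟩ : WeierstrassCurve ℚ) ⟨0, 1, 1, 3, 2⟩ 3 := by
  haveI := isElliptic_52779b1
  haveI := isElliptic_219b1
  exact threeCongruent_of_hesseCertificate_unconditional ⟨0, 1, 1, 3, 2⟩ ⟨0, 1, 1, -22689, -1340611⟩
    6 1 2 (by norm_num)
    (by rw [eval_hesseC4three, c₄_219b1, c₆_219b1, c₄_52779b1]; norm_num)
    (by rw [eval_hesseC6three, c₄_219b1, c₆_219b1, c₆_52779b1]; norm_num)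

/-- **`52779b1[3]` is reducible — IN THE KERNEL**: `x₀ = 261` is a rational root of `Ψ₃` with
`Ψ₂Sq(261) = 42341049 = 6507² ≠ 0`, so `(261, 3253)` spans a rational `3`-line. Discharges the display's
binder `hred`. [folklore] -/
theorem not_irreducible_52779b1 :
    ¬ (⟨0, 1, 1, -22689, -1340611⟩ : WeierstrassCurve ℚ).HasIrreducibleModPGaloisRep 3 := by
  haveI := isElliptic_52779b1
  obtain ⟨Φ, P, y, h, hΦ, -⟩ :=
    KernelDisc.exists_isRationalLine_of_eval_Ψ₃_eq_zero (W := ⟨0, 1, 1, -22689, -1340611⟩) 261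
      (by norm_num [WeierstrassCurve.Ψ₃, WeierstrassCurve.b₂, WeierstrassCurve.b₄, WeierstrassCurve.b₆,
            WeierstrassCurve.b₈])
      (by rw [KernelDisc.eval_Ψ₂Sq]; norm_num [WeierstrassCurve.b₂, WeierstrassCurve.b₄, WeierstrassCurve.b₆])
  exact not_hasIrreducibleModPGaloisRep_of_isRationalLine hΦ

/-- **The display with `hiso` and `hred` DISCHARGED: Mazur's main conjecture at `(52779b1, 3)`** from the
registered class-level facts and the per-pair INSTRUMENT certificates only (`r_an(219b1) = 1`,
`(μ, λ)_an = (0, 3)` / `(0, 2)`) — `RouteGSplitDisplay52779b1.mazurMainConjectureAt_52779b1_at_three` with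
`torsionIso_52779b1_219b1` and `not_irreducible_52779b1` plugged in. CONDITIONAL on the instrument
certificates; nothing booked. [cite: GreenbergVatsal2000, Thm. (1.4), §2 Prop. (2.4)]
[cite: Wuthrich2014, Thm. 16 (p. 397)] [cite: Fisher2012Hessian, Thm. 13.2 (n = 3)] -/
theorem mazurMainConjectureAt_52779b1_at_three_of_certs
    (hWu : thm16_charIdeal_dvd_multiplicative_of_reducible)
    (hJs : thm61_splitMultiplicative) (hJn : thm61_nonsplitMultiplicative)
    (hHs : exists_isSplitMultCanonical) (hHn : exists_isMultCanonical)
    (hGZK : rank_eq_analyticRank_of_analyticRank_le_one)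
    (hpar : nonempty_modularParametrizationData)
    (hT : Silverman1994_thmV53_corV54_tateUniformisation.{0})
    (hT' : Silverman1994_thmV53_tateUniformisation.{0})
    (hAm : lambda_nonPrimitive_eq_add_sum_delta_multiplicative)
    (hBm : datumSelmer_divisible_of_finite_torsionBy) (hF : datumStrictSelmer_lt_datumSelmer_of_split)
    (W W' : WeierstrassCurve ℚ) [W.IsElliptic] [W.IsGloballyMinimal] [W'.IsElliptic]
    [W'.IsGloballyMinimal] (hW : W = ⟨0, 1, 1, -22689, -1340611⟩) (hW' : W' = ⟨0, 1, 1, 3, 2⟩)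
    (hr' : W'.analyticRank = 1)
    (hμ0 : AnalyticMuLE W 3 0) (hlam : AnalyticLambdaEq W 3 3)
    (hμ0' : AnalyticMuLE W' 3 0) (hlam' : AnalyticLambdaEq W' 3 2) :
    X2.MazurMainConjectureAt W 3 := by
  subst hW hW'
  exact mazurMainConjectureAt_52779b1_at_three hWu hJs hJn hHs hHn hGZK hpar hT hT' hAm hBm hF _ _ rfl rfl
    not_irreducible_52779b1 torsionIso_52779b1_219b1 hr' hμ0 hlam hμ0' hlam'

/-- **`BSD(52779b1, 3)` with `hiso` and `hred` DISCHARGED** — `RouteGSplitDisplay52779b1.bsdp_52779b1_at_three`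
with the two Galois-side certificates plugged in; per-pair binders left: `hr : r_an(W) = 0`,
`hr' : r_an(W') = 1`, `(μ, λ)_an ×2` [instrument] and Greenberg–Stevens `hGS` [PUB]. CONDITIONAL on the
instrument certificates; nothing booked. [cite: GreenbergVatsal2000, Thm. (1.4), §2 Prop. (2.4)]
[cite: Wuthrich2014, Thm. 16 (p. 397)] [cite: SteinWuthrich2013, Thm. 6.1 (p. 20)]
[cite: Fisher2012Hessian, Thm. 13.2 (n = 3)] [cite: Miller2011LMS, Def. 1.1] -/
theorem bsdp_52779b1_at_three_of_certs
    (hWu : thm16_charIdeal_dvd_multiplicative_of_reducible)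
    (hJs : thm61_splitMultiplicative) (hJn : thm61_nonsplitMultiplicative)
    (hHs : exists_isSplitMultCanonical) (hHn : exists_isMultCanonical)
    (hGZK : rank_eq_analyticRank_of_analyticRank_le_one) (hmod : hasEntireLFunction_rat)
    (hpar : nonempty_modularParametrizationData)
    (hT : Silverman1994_thmV53_corV54_tateUniformisation.{0})
    (hT' : Silverman1994_thmV53_tateUniformisation.{0})
    (hAm : lambda_nonPrimitive_eq_add_sum_delta_multiplicative)
    (hBm : datumSelmer_divisible_of_finite_torsionBy) (hF : datumStrictSelmer_lt_datumSelmer_of_split)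
    (W W' : WeierstrassCurve ℚ) [W.IsElliptic] [W.IsGloballyMinimal] [W'.IsElliptic]
    [W'.IsGloballyMinimal] (hW : W = ⟨0, 1, 1, -22689, -1340611⟩) (hW' : W' = ⟨0, 1, 1, 3, 2⟩)
    (hGS : greenberg_stevens (W := W) (p := 3))
    (hr : W.analyticRank = 0) (hr' : W'.analyticRank = 1)
    (hμ0 : AnalyticMuLE W 3 0) (hlam : AnalyticLambdaEq W 3 3)
    (hμ0' : AnalyticMuLE W' 3 0) (hlam' : AnalyticLambdaEq W' 3 2) :
    BSDp W 3 := by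
  subst hW hW'
  exact bsdp_52779b1_at_three hWu hJs hJn hHs hHn hGZK hmod hpar hT hT' hAm hBm hF _ _ rfl rfl hGS
    not_irreducible_52779b1 torsionIso_52779b1_219b1 hr hr' hμ0 hlam hμ0' hlam'

end Summit.BirchSwinnertonDyer.Rank1Residual.X2.RouteGSplitDisplay52779b1Certs

end
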